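import Summits.ABC.IUTFork.LDHGenuine
import Summits.ABC.IUTFork.LDHCor312Skel
import HarnessLib

/-!
# The fork at [IUTchIII] Corollary 3.12 — the PRE-HULL readings are FALSE GLOBALLY for EVERY genuine input in
# the sharp L-DH model (skeleton XXVId)

Record-only file (D-0012) of the abc-iut cell (deliverable (a), skeleton seat abc-iut-skel, gen 6); TAKES NO
SIDE. GLOBAL sequel of XXVIb (`ForkPacketPreHull`, p417570: at ONE summand of a real prime packet the pre-hull
readings — Team B's single-image transport, R1 / LANA (9-1) at volume level — fail at every bad place for
`j ≥ 2` by the Θ-weights alone). Here the same is proved for the WHOLE procession-normalised, prime-summed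
Dupuy–Hilado log-volume `ln ν̄_𝕃` of abc-iut-c312-3 / c312-d1 / S2's GENUINE datum `DHData.ofInput I` of an
arbitrary genuine Θ-volume input `I : ThetaVolumeInput F₀ K` (`LDHGenuine`: Mochizuki's container
`tensorPacketModelM` over the genuine completions `K_{v̲}`, genuine ideles realising `P_Θ`, `P_q`, the minimal =
SHARP (Ind3)-datum `ofIdelesM` — the datum that EXISTS in that container, c312-3 `minimalDHDatumM`; with
Dupuy–Hilado's log-shell normalisation no (Ind3)-datum exists at wild tuples, HOME/plan/c312/R7C3Q1-COMPUTATION.md):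

* `lnνL_bare3_ofInput` — `ln ν̄_𝕃((O_𝕃(−P_Θ))^{Ind3}) = −deĝ̲_lgp(P_Θ)` (sharpness `ofInput_sharp` + Dupuy–Hilado
  Thm. 3.10.1 `lnνL_regionΘ`);
* `lnνL_UTheta_ofInput` — EVERY possible image `U_λ = g·σ·(O_𝕃(−P_Θ))^{Ind3}` of the Θ-pilot (pre-hull) has
  `ln ν̄_𝕃(U_λ) = −deĝ̲_lgp(P_Θ)` ((Ind1)/(Ind2) preserve `ln ν̄_𝕃`: c312-3 `lnνL_UTheta`, a theorem of the model);
* **`lnνL_UTheta_lt_negAbsLogqDH_ofInput`** — hence `ln ν̄_𝕃(U_λ) < −|log(q)|_DH = −deĝ̲(P_q)` for EVERY `λ`, by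
  (Syp2) `deĝ̲(P_q) < deĝ̲_lgp(P_Θ)` (c312-3 `ndeg_qPilot_lt_ndegLgp_thetaPilot`; [IUTchIV] Step (v) weights `j²`
  against the q-pilot's `1`; Mochizuki EssLgc §3.6 (Syp2); Scholze–Stix 2018 §2.1.8): every possible image of
  the Θ-pilot, BEFORE the holomorphic hull, is globally TOO SMALL to carry the q-pilot log-volume;
  `lnνL_lt_negAbsLogqDH_of_subset_UTheta` — and so is every admissible sub-region of a possible image;
* **`not_representedVol_ofInput`** — Reading R1 = LANA (9-1) at the log-volume level (skeleton XVII
  `Cor312Setting.RepresentedVol` on the CONSTRUCTED setting `DHData.toSetting`, c312-3 `LDHCor312Skel`) is FALSE for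
  every genuine input; `not_mainGoal_ofInput` — so is the carried η-setting's (9-1) (`ForkEta.EtaSetting.MainGoal`,
  XVII `mainGoal_iff_representedVol`), for every choice of the pointed line;
* **`not_preHullTransport_ofInput`** — the Dupuy–Hilado-level shape of Team B's `GlobalVolumeTransport`
  («`−|log(q)| ≤ ln ν̄_𝕃` of ONE chosen possible image») is FALSE for every genuine input;
* (v2) `not_region_tq_subset_UTheta_ofInput` / `region_tq_ne_UTheta_ofInput` — the q-pilot region `O_𝕃(−P_q)` lies in NO
  possible image and IS none: the set-level reading R3 under the printed pins ((pΘ),(pq′): both regions = Kummer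
  images; (G-PINNED) GapA″ shape) fails at the L-DH level for every genuine input and every `λ`;
* CONTRAST (honesty, cited not re-proved): under an ENLARGING (Ind3)-datum R1 holds iff the enlargement ALONE
  inflates `O_𝕃(−P_Θ)` by exactly `deĝ̲_lgp − deĝ̲` (c312-3 `representedVol_iff_ind3_gap`); and the HULL-level
  Dupuy–Hilado inequality (1.1) `Cor312DH (ofInput I)` (= `I.Cor312Of`, the printed inequality's DH form) is NOT
  touched here — `free_inequality` holds, the hull estimate `hullEstimateOf_ofInput` holds, and whether the hull
  inflates by the gap is exactly the open question (`gap_le_of_cor312Of`).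

READING for the 12:30Z block (B-row / R1 grading; PR-4 companion `Cor312WeakenToPrint`): in the genuine sharp
L-DH model the pre-hull forms are not merely STRONGER-THAN-PRINT but FALSE for every input — no depth
condition, no one-place-over-`p` condition, fully global; whatever could make the printed inequality true there is
the HULL. Summand-level twin: XXVIb p417570; hull-level deep-place failures: XXVI p417081, w5-d157 p417488/p417638,
c312-10 p417644; hull-level converse at mixed summands: XXVIc p418215. Sources: [IUTchIII] kurims
`paper:url-4b091feeb646` pp. 173–174, 184; [IUTchIV] kurims `paper:url-56bcb0f95768` pp. 27–28; Dupuy–Hilado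
arXiv:2004.13228 §1 (1.1), §3.9, Thm. 3.10.1, §4.7, §4.9–4.12; LANA report §8.3 p. 43, §9.2 (9-1) p. 46; Mochizuki
EssLgc §3.6 (Syp2) (RIMS-1968 p. 104). [claim: Mochizuki2012, status: disputed]; [cite: DupuyHilado2025, §1 (1.1),
Thm. 3.10.1, §4.11]; [cite: LANA2026Report, §9.2 p. 46]; [cite: Mochizuki2022EssLgc, §3.6 (Syp2) p. 104].
typed ≠ proved; no side taken.
-/

noncomputable section

open Set Finset

namespace Summit.ABC.IUTFork

open Literature.IUT.LogVolume NumberField IsDedekindDomain RegionEncoding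

namespace DHData

variable {F₀ : Type} [Field F₀] [NumberField F₀] {K : Type} [Field K] [NumberField K] [Algebra F₀ K]
variable (I : ThetaVolumeInput F₀ K)

/-- `ln ν̄_{𝕃_p}` reads only the components over `p` (private copy of the `ValLine` bookkeeping lemma).
[folklore] -/
private theorem lnνLp_congr' {F : Type} [Field F] [NumberField F] {M : PacketModel F} (lstar p : ℕ)
    {A B : M.Region} (h : ∀ j e, A p j e = B p j e) : M.lnνLp lstar p A = M.lnνLp lstar p B := by
  simp [PacketModel.lnνLp, PacketModel.lnνTensorPower, h]

/-! ## 1. Every possible image of the genuine Θ-pilot has global log-volume `−deĝ̲_lgp(P_Θ)` -/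

/-- **`ln ν̄_𝕃((O_𝕃(−P_Θ))^{Ind3}) = −deĝ̲_lgp(P_Θ)`** for the genuine datum: the (Ind3)-datum of `ofInput I` is
SHARP (`ofInput_sharp`: it IS the bare region `O_𝕃(−P_Θ)` at every prime), and Dupuy–Hilado Thm. 3.10.1
(`lnνL_regionΘ`). [cite: DupuyHilado2025, Thm. 3.10.1, §4.10] -/
theorem lnνL_bare3_ofInput :
    (ofInput I).M.lnνL (ofInput I).X.lstar (ofInput I).T (ofInput I).ind3.bare3 =
      -LgpDivisor.ndegLgp (ofInput I).X.thetaPilot := by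
  rw [← lnνL_regionΘ]
  refine Finset.sum_congr rfl fun p hp => lnνLp_congr' _ _ fun j e => ?_
  exact ofInput_sharp I ((ofInput I).T_prime p hp) j e

/-- **Every possible image `U_λ = g·σ·(O_𝕃(−P_Θ))^{Ind3}` of the genuine Θ-pilot (pre-hull) has
`ln ν̄_𝕃(U_λ) = −deĝ̲_lgp(P_Θ)`**: (Ind1)/(Ind2) preserve `ln ν̄_𝕃` (c312-3 `lnνL_UTheta`, a theorem of the packet
model). [cite: DupuyHilado2025, §4.7, §4.9, §4.11] -/
theorem lnνL_UTheta_ofInput (lam : (ofInput I).M.Ind2Elt × (ofInput I).M.Ind1Elt) :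
    (ofInput I).M.lnνL (ofInput I).X.lstar (ofInput I).T ((ofInput I).M.UTheta (ofInput I).ind3 lam) =
      -LgpDivisor.ndegLgp (ofInput I).X.thetaPilot := by
  rw [lnνL_UTheta, lnνL_bare3_ofInput]

/-! ## 2. (Syp2) globally: every possible image is too small to carry `−|log(q)|` -/

/-- **Every possible image of the genuine Θ-pilot has global log-volume STRICTLY BELOW `−|log(q)|_DH`**:
`ln ν̄_𝕃(U_λ) = −deĝ̲_lgp(P_Θ) < −deĝ̲(P_q) = ln ν̄_𝕃(O_𝕃(−P_q))` — (Syp2) (`ndeg_qPilot_lt_ndegLgp_thetaPilot`: the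
Θ-weights `j²` against the q-pilot's `1`) for EVERY genuine input and EVERY indeterminacy `λ`.
[cite: Mochizuki2022EssLgc, §3.6 (Syp2) p. 104] -/
theorem lnνL_UTheta_lt_negAbsLogqDH_ofInput (lam : (ofInput I).M.Ind2Elt × (ofInput I).M.Ind1Elt) :
    (ofInput I).M.lnνL (ofInput I).X.lstar (ofInput I).T ((ofInput I).M.UTheta (ofInput I).ind3 lam) <
      (ofInput I).negAbsLogqDH := by
  rw [lnνL_UTheta_ofInput, negAbsLogqDH, lnνL_regionq]
  have h := ndeg_qPilot_lt_ndegLgp_thetaPilot (ofInput I)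
  linarith

/-- … and so is every ADMISSIBLE SUB-REGION of a possible image (monotonicity of `ln ν̄_𝕃`): no single image,
and nothing inside one, carries the q-pilot log-volume. [cite: DupuyHilado2025, §3.6, §4.11] -/
theorem lnνL_lt_negAbsLogqDH_of_subset_UTheta (lam : (ofInput I).M.Ind2Elt × (ofInput I).M.Ind1Elt)
    {A : (ofInput I).M.Region} (hA : (ofInput I).M.RegionAdm A)
    (hsub : ∀ p j e, A p j e ⊆ (ofInput I).M.UTheta (ofInput I).ind3 lam p j e) :
    (ofInput I).M.lnνL (ofInput I).X.lstar (ofInput I).T A < (ofInput I).negAbsLogqDH :=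
  lt_of_le_of_lt ((ofInput I).M.lnνL_mono _ _ hA ((ofInput I).M.UTheta_adm (ofInput I).ind3 lam) hsub)
    (lnνL_UTheta_lt_negAbsLogqDH_ofInput I lam)

/-! ## 3. Hence R1 / (9-1) at volume level and the pre-hull transport are FALSE for every genuine input -/

/-- **R1 = LANA (9-1) at the log-volume level is FALSE for every genuine input** in the sharp L-DH model: no
possible image of the Θ-pilot has the q-pilot's log-volume (skeleton XVII `Cor312Setting.RepresentedVol` on the
CONSTRUCTED setting `DHData.toSetting`; c312-3 `representedVol_iff`).
[cite: LANA2026Report, §9.2 (9-1) p. 46] -/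
theorem not_representedVol_ofInput : ¬ (ofInput I).toSetting.RepresentedVol := by
  rw [representedVol_iff, lnνL_bare3_ofInput]
  have h := ndeg_qPilot_lt_ndegLgp_thetaPilot (ofInput I)
  intro heq
  linarith

/-- … equivalently, LANA's MAIN GOAL (9-1) for the η-setting carried by that setting (skeleton XV/XVII
`EtaSetting.MainGoal`, `mainGoal_iff_representedVol`) is FALSE, for every choice of the pointed line `ℝ^val`.
[cite: LANA2026Report, §9.2 (9-1) p. 46] -/
theorem not_mainGoal_ofInput (Rval : PointedLine) : ¬ ((ofInput I).toSetting.toEtaSetting Rval).MainGoal := by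
  rw [Cor312Setting.mainGoal_iff_representedVol]
  exact not_representedVol_ofInput I

/-- **The Dupuy–Hilado-level shape of Team B's pre-hull `GlobalVolumeTransport` is FALSE for every genuine
input**: there is NO indeterminacy `λ` with `−|log(q)|_DH ≤ ln ν̄_𝕃(U_λ)` (the q-pilot log-volume is not
dominated by the log-volume of any single possible image). [claim: Mochizuki2012, status: disputed] -/
theorem not_preHullTransport_ofInput :
    ¬ ∃ lam : (ofInput I).M.Ind2Elt × (ofInput I).M.Ind1Elt,
      (ofInput I).negAbsLogqDH ≤
        (ofInput I).M.lnνL (ofInput I).X.lstar (ofInput I).T ((ofInput I).M.UTheta (ofInput I).ind3 lam) := by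
  rintro ⟨lam, h⟩
  have h' := lnνL_UTheta_lt_negAbsLogqDH_ofInput I lam
  linarith

/-- Nor does any admissible sub-region of any possible image dominate it (the iso / sub-region variants of the
pre-hull readings). [claim: Mochizuki2012, status: disputed] -/
theorem not_preHullSubTransport_ofInput :
    ¬ ∃ (lam : (ofInput I).M.Ind2Elt × (ofInput I).M.Ind1Elt) (A : (ofInput I).M.Region),
      (ofInput I).M.RegionAdm A ∧ (∀ p j e, A p j e ⊆ (ofInput I).M.UTheta (ofInput I).ind3 lam p j e) ∧
        (ofInput I).negAbsLogqDH ≤ (ofInput I).M.lnνL (ofInput I).X.lstar (ofInput I).T A := by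
  rintro ⟨lam, A, hA, hsub, h⟩
  have h' := lnνL_lt_negAbsLogqDH_of_subset_UTheta I lam hA hsub
  linarith

/-! ## 4. What is NOT touched: the hull -/

/-- The HULL-level inequality (1.1) for the genuine datum (`Cor312DH (ofInput I)`, which gives the input's
`Cor312Of` by c312-3/S2's `cor312Of_of_cor312DH`) is NOT touched here; what this file shows is that in the
genuine sharp model it can only come from the HULL: `free_inequality` puts every pre-hull image AT
`−deĝ̲_lgp(P_Θ) ≤ −|log(Θ)|_DH`, strictly below `−|log(q)|_DH`. [claim: Mochizuki2012, status: disputed] -/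
theorem preHull_gap_summary (lam : (ofInput I).M.Ind2Elt × (ofInput I).M.Ind1Elt) :
    (ofInput I).M.lnνL (ofInput I).X.lstar (ofInput I).T ((ofInput I).M.UTheta (ofInput I).ind3 lam) <
        (ofInput I).negAbsLogqDH ∧
      (ofInput I).M.lnνL (ofInput I).X.lstar (ofInput I).T ((ofInput I).M.UTheta (ofInput I).ind3 lam) ≤
        (ofInput I).negLogThetaDH :=
  ⟨lnνL_UTheta_lt_negAbsLogqDH_ofInput I lam, by rw [lnνL_UTheta_ofInput]; exact free_inequality (ofInput I)⟩

/-! ## 5. (v2) R3 under the pins, at the genuine L-DH level: the q-pilot region is NOT a possible image -/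

/-- **The q-pilot region `O_𝕃(−P_q)` is contained in NO possible image of the Θ-pilot** (genuine input, sharp
L-DH model): containment would give `ln ν̄_𝕃(O_𝕃(−P_q)) ≤ ln ν̄_𝕃(U_λ) < ln ν̄_𝕃(O_𝕃(−P_q))`. This is the
Dupuy–Hilado-level failure, for EVERY genuine input and EVERY indeterminacy `λ`, of the set-level reading R3
read under the printed pins ((pΘ) Θ-regions = the Kummer images `U_λ`, (pq′) q-region = the Kummer image
`O_𝕃(−P_q)`; ADJUDICATION-SPEC (G-PINNED) GapA″ shape) — a statement about the L-DH model, not about the frozen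
`Cor312.Setting` PR-2 works in. [claim: Mochizuki2012, status: disputed] -/
theorem not_region_tq_subset_UTheta_ofInput (lam : (ofInput I).M.Ind2Elt × (ofInput I).M.Ind1Elt) :
    ¬ ∀ p j e, (ofInput I).M.region (ofInput I).tq p j e ⊆ (ofInput I).M.UTheta (ofInput I).ind3 lam p j e := by
  intro hsub
  have h1 := (ofInput I).M.lnνL_mono (ofInput I).X.lstar (ofInput I).T ((ofInput I).M.region_adm (ofInput I).tq)
    ((ofInput I).M.UTheta_adm (ofInput I).ind3 lam) hsub
  have h2 := lnνL_UTheta_lt_negAbsLogqDH_ofInput I lam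
  rw [negAbsLogqDH] at h2
  linarith

/-- … in particular `O_𝕃(−P_q) ≠ U_λ` for every `λ`: the q-pilot region IS NOT a possible image of the Θ-pilot
in the genuine sharp L-DH model. [claim: Mochizuki2012, status: disputed] -/
theorem region_tq_ne_UTheta_ofInput (lam : (ofInput I).M.Ind2Elt × (ofInput I).M.Ind1Elt) :
    (ofInput I).M.region (ofInput I).tq ≠ (ofInput I).M.UTheta (ofInput I).ind3 lam := by
  intro heq
  exact not_region_tq_subset_UTheta_ofInput I lam fun p j e => (congrFun (congrFun (congrFun heq p) j) e).le

/-- Nor is any possible image contained in the q-pilot region with equal volume… precisely: a possible image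
MAY lie inside `O_𝕃(−P_q)` (it is smaller), but then STRICTLY — its log-volume stays `< −|log(q)|_DH`; so
neither containment direction yields the volume EQUALITY (9-1)/R1 asks for. [folklore] -/
theorem lnνL_UTheta_ne_negAbsLogqDH_ofInput (lam : (ofInput I).M.Ind2Elt × (ofInput I).M.Ind1Elt) :
    (ofInput I).M.lnνL (ofInput I).X.lstar (ofInput I).T ((ofInput I).M.UTheta (ofInput I).ind3 lam) ≠
      (ofInput I).negAbsLogqDH :=
  (lnνL_UTheta_lt_negAbsLogqDH_ofInput I lam).ne

end DHData

end Summit.ABC.IUTFork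

end
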